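import Mathlib
import Summits.MatrixMultiplication.MatrixMultiplication.Theses.MatrixPointInterpolation
import Summits.MatrixMultiplication.MatrixMultiplication.Theorems.MatrixPointInterpolationWindowedKaplanskyPolys
import Summits.MatrixMultiplication.MatrixMultiplication.Theorems.LongMasquerade.Negative.WindowedKaplanskyTwoLemmas

/-!
# `MatrixPointInterpolation.WindowedKaplansky` (stmt-MatrixMultiplication-18945) — helper file 2:
# the Cayley–Hamilton–Capelli identity and the algebraicity dichotomy, uniform in `k`

The **Cayley–Hamilton–Capelli polynomial** of order `K`,
`P_K(y; z_0, …, z_{K-1}) = ∑_{σ ∈ S_{K+1}} sgn σ · y^{σ 0} z_0 y^{σ 1} z_1 ⋯ z_{K-1} y^{σ K}`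
(`capPow K y z`), is the Capelli polynomial `C_{K+1}` evaluated at the powers `1, y, …, y^K`; it is
an identity of `M_K(ℂ)` because these powers are linearly dependent (Cayley–Hamilton) and `C_{K+1}`
is alternating (`capPow_matrix_eq_zero`).  For a pair `A` masquerading as `M_k` to degree `2d` and
generating `M_n` in degree `d` (`V_d = M_n`), the window transfers it to `M_n` with filtered
arguments (`capPow_eq_zero_of_window`: `Y ∈ V_L`, `Z_i ∈ V_{e_i}`, `L·k(k+1)/2 + ∑ e_i ≤ 2d`), and
expanding along the first separator slot `z_0 ↦ X ∈ V_d = M_n` (a *full* slot) and separating the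
tensor `∑_p Y^p ⊗ R_p` (`eq_zero_of_sum_mul_mul_eq_zero`) gives the **algebraicity dichotomy**
(`capPow_dichotomy`): for every `Y ∈ V_L` either `1, Y, …, Y^{K+1}` are linearly dependent, or the
order-`K` polynomial `P_K(Y; Z')` vanishes for all `Z' ∈ V_e^K` (budget
`L(K+1)(K+2)/2 + d + K e ≤ 2d`).  For `k = K + 1 = 2` the second branch says `[Z', Y] = 0` on
`V_e ∋ A 0, A 1`, so `Y` is scalar: every element of `V_1 = span{1, A 0, A 1}` is quadratic, which
bounds `n ≤ 2` (file `…WindowedKaplanskyTwoSharp`).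
-/

namespace Summit.MatrixMultiplication.MatrixMultiplication.Theorems

namespace Masquerade

open MonoidAlgebra Equiv

/-! ### The Cayley–Hamilton–Capelli polynomial -/

section capPow

variable {R : Type*} [Ring R]

/-- The monomial `y^{σ 0} z_0 y^{σ 1} z_1 ⋯ z_{K-1} y^{σ K}` of the Cayley–Hamilton–Capelli
polynomial. [folklore] -/
def capMon (K : ℕ) (y : R) (z : Fin K → R) (σ : Perm (Fin (K + 1))) : R :=
  y ^ (σ 0 : ℕ) * (List.ofFn fun i : Fin K => z i * y ^ (σ i.succ : ℕ)).prod

/-- The Cayley–Hamilton–Capelli polynomial `P_K(y; z) = ∑_σ sgn σ · y^{σ 0} z_0 ⋯ z_{K-1} y^{σ K}`,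
in any ring. [folklore] -/
def capPow (K : ℕ) (y : R) (z : Fin K → R) : R :=
  ∑ σ : Perm (Fin (K + 1)), Perm.sign σ • capMon K y z σ

/-- Ring homomorphisms commute with `capPow`. [folklore] -/
theorem map_capPow {S F : Type*} [Ring S] [FunLike F R S] [RingHomClass F R S] (f : F) (K : ℕ)
    (y : R) (z : Fin K → R) : f (capPow K y z) = capPow K (f y) (f ∘ z) := by
  simp only [capPow, map_sum]
  refine Finset.sum_congr rfl fun σ _ => ?_
  rw [Units.smul_def, Units.smul_def, map_zsmul]
  congr 1
  simp only [capMon, map_mul, map_pow, map_list_prod, List.map_ofFn]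
  congr 2
  exact congrArg List.ofFn (funext fun i => by simp)

/-- `P_0(y) = 1`. [folklore] -/
theorem capPow_zero (y : R) (z : Fin 0 → R) : capPow 0 y z = 1 := by
  simp [capPow, capMon, Finset.univ_unique]

end capPow

/-! ### It is an identity of `M_K(ℂ)` -/

section identity

variable {R : Type*} [Ring R] [Algebra ℂ R]

/-- The multilinear map `t ↦ t_0 z_0 t_1 z_1 ⋯ z_{K-1} t_K`. [folklore] -/
noncomputable def capMulti (K : ℕ) (z : Fin K → R) : MultilinearMap ℂ (fun _ : Fin (K + 1) => R) R :=
  (MultilinearMap.mkPiAlgebraFin ℂ (K + 1) R).compLinearMap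
    fun i => LinearMap.mulLeft ℂ ((Fin.cons (1 : R) z : Fin (K + 1) → R) i)

/-- The formula for `capMulti`. [folklore] -/
theorem capMulti_apply (K : ℕ) (z : Fin K → R) (t : Fin (K + 1) → R) :
    capMulti K z t = t 0 * (List.ofFn fun i : Fin K => z i * t i.succ).prod := by
  simp only [capMulti, MultilinearMap.compLinearMap_apply, MultilinearMap.mkPiAlgebraFin_apply,
    LinearMap.mulLeft_apply, List.ofFn_succ, List.prod_cons, Fin.cons_zero, Fin.cons_succ, one_mul]

/-- `capPow` is the alternatisation of `capMulti` evaluated at the powers of `y`. [folklore] -/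
theorem capPow_eq_alternatization (K : ℕ) (y : R) (z : Fin K → R) :
    capPow K y z = MultilinearMap.alternatization (capMulti K z) (fun i : Fin (K + 1) => y ^ (i : ℕ)) := by
  rw [MultilinearMap.alternatization_apply, capPow]
  refine Finset.sum_congr rfl fun σ _ => ?_
  rw [MultilinearMap.domDomCongr_apply, capMulti_apply]
  rfl

/-- The powers `1, y, …, y^K` of a `K × K` matrix are linearly dependent (Cayley–Hamilton).
[folklore] -/
theorem not_linearIndependent_pow (K : ℕ) (y : Matrix (Fin K) (Fin K) ℂ) :
    ¬ LinearIndependent ℂ (fun i : Fin (K + 1) => y ^ (i : ℕ)) := by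
  rw [Fintype.not_linearIndependent_iff]
  refine ⟨fun i => y.charpoly.coeff i, ?_, ⟨Fin.last K, ?_⟩⟩
  · have h := Matrix.aeval_self_charpoly y
    rw [Polynomial.aeval_eq_sum_range, Matrix.charpoly_natDegree_eq_dim, Fintype.card_fin] at h
    rw [← h, ← Fin.sum_univ_eq_sum_range (fun i => y.charpoly.coeff i • y ^ i) (K + 1)]
  · have h := y.charpoly_monic
    rw [Polynomial.Monic, Polynomial.leadingCoeff, Matrix.charpoly_natDegree_eq_dim,
      Fintype.card_fin] at h
    simp [h]

/-- **Cayley–Hamilton–Capelli identity**: `P_K(y; z) = 0` on `M_K(ℂ)`. [folklore] -/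
theorem capPow_matrix_eq_zero (K : ℕ) (y : Matrix (Fin K) (Fin K) ℂ)
    (z : Fin K → Matrix (Fin K) (Fin K) ℂ) : capPow K y z = 0 := by
  rw [capPow_eq_alternatization]
  exact AlternatingMap.map_linearDependent _ _ (not_linearIndependent_pow K y)

end identity

/-! ### Transfer through the window -/

section transfer

/-- Degree of the Cayley–Hamilton–Capelli polynomial of polynomials. [folklore] -/
theorem deg_capPow_le (K : ℕ) {p : NCPoly} {q : Fin K → NCPoly} {L : ℕ} {e : Fin K → ℕ}
    (hp : deg p ≤ L) (hq : ∀ i, deg (q i) ≤ e i) :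
    deg (capPow K p q) ≤ L * (K * (K + 1) / 2) + ∑ i, e i := by
  have hsum : ∀ σ : Perm (Fin (K + 1)), (σ 0 : ℕ) * L + ∑ i : Fin K, (e i + (σ i.succ : ℕ) * L)
      = L * (K * (K + 1) / 2) + ∑ i, e i := by
    intro σ
    have h1 : ∑ j : Fin (K + 1), (σ j : ℕ) = K * (K + 1) / 2 := by
      rw [Equiv.sum_comp σ (fun j : Fin (K + 1) => (j : ℕ)), Fin.sum_univ_eq_sum_range (fun i => i),
        Finset.sum_range_id, Nat.add_sub_cancel, Nat.mul_comm]
    rw [Finset.sum_add_distrib, ← h1, Fin.sum_univ_succ, ← Finset.sum_mul]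
    ring
  refine deg_sum_le fun σ _ => deg_units_smul_le _ ?_
  rw [← hsum σ, capMon]
  refine deg_mul_le (by simpa [Nat.mul_comm] using deg_pow_le hp (σ 0 : ℕ)) ?_
  rw [List.ofFn_eq_map, Fin.sum_univ_def]
  refine deg_list_prod_le _ (fun i => e i + (σ i.succ : ℕ) * L) _ fun i _ => ?_
  exact deg_mul_le (hq i) (by simpa [Nat.mul_comm] using deg_pow_le hp (σ i.succ : ℕ))

/-- **Window transfer of the Cayley–Hamilton–Capelli identity.**  If `A` masquerades as `M_k`
to degree `2d`, then `P_k(Y; Z) = 0` in `M_n` for `Y ∈ V_L`, `Z_i ∈ V_{e_i}` whenever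
`L · k(k+1)/2 + ∑ e_i ≤ 2d`. [folklore] -/
theorem capPow_eq_zero_of_window {n k d : ℕ} {A : Fin 2 → Matrix (Fin n) (Fin n) ℂ}
    (hmasq : ∀ (T : Finset (List (Fin 2))) (c : List (Fin 2) → ℂ), (∀ w ∈ T, w.length ≤ 2 * d) →
      (∀ B : Fin 2 → Matrix (Fin k) (Fin k) ℂ, (∑ w ∈ T, c w • (w.map B).prod) = 0) →
      (∑ w ∈ T, c w • (w.map A).prod) = 0)
    {L : ℕ} {e : Fin k → ℕ} (hbudget : L * (k * (k + 1) / 2) + ∑ i, e i ≤ 2 * d)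
    {Y : Matrix (Fin n) (Fin n) ℂ} (hY : Y ∈ wordSpan A L)
    {Z : Fin k → Matrix (Fin n) (Fin n) ℂ} (hZ : ∀ i, Z i ∈ wordSpan A (e i)) :
    capPow k Y Z = 0 := by
  obtain ⟨p, hp, rfl⟩ := exists_poly_of_mem_wordSpan hY
  choose q hq hqZ using fun i => exists_poly_of_mem_wordSpan (hZ i)
  obtain rfl : Z = fun i => eval₂ A (q i) := funext fun i => (hqZ i).symm
  have key : eval₂ A (capPow k p q) = 0 :=
    window_eval₂ hmasq _ ((deg_capPow_le k hp hq).trans hbudget) fun B => by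
      rw [map_capPow, capPow_matrix_eq_zero]
  rwa [map_capPow] at key

end transfer

/-! ### Expansion along the first separator slot and tensor separation -/

section expansion

variable {R : Type*} [Ring R]

/-- The tail `y^{σ 1} z'_0 y^{σ 2} ⋯ z'_{K-1} y^{σ (K+1)}` of a monomial of `P_{K+1}` after its first
separator. [folklore] -/
def capTail (K : ℕ) (y : R) (z' : Fin K → R) (σ : Perm (Fin (K + 2))) : R :=
  y ^ (σ 1 : ℕ) * (List.ofFn fun i : Fin K => z' i * y ^ (σ i.succ.succ : ℕ)).prod

/-- A monomial of `P_{K+1}(y; x, z')` factors as `y^{σ 0} · x · (tail)`. [folklore] -/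
theorem capMon_succ_cons (K : ℕ) (y x : R) (z' : Fin K → R) (σ : Perm (Fin (K + 2))) :
    capMon (K + 1) y (Fin.cons x z') σ = y ^ (σ 0 : ℕ) * x * capTail K y z' σ := by
  simp only [capMon, capTail, List.ofFn_succ, List.prod_cons, Fin.cons_zero, Fin.cons_succ,
    Fin.succ_zero_eq_one, mul_assoc]

/-- The fibre sums `R_p = ∑_{σ 0 = p} sgn σ · (tail of σ)`. [folklore] -/
def capRest (K : ℕ) (y : R) (z' : Fin K → R) (p : Fin (K + 2)) : R :=
  ∑ σ ∈ Finset.univ.filter (fun σ : Perm (Fin (K + 2)) => σ 0 = p), Perm.sign σ • capTail K y z' σ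

/-- Expansion of `P_{K+1}(y; x, z')` along the first separator:
`P_{K+1}(y; x, z') = ∑_p y^p · x · R_p`. [folklore] -/
theorem capPow_succ_cons (K : ℕ) (y x : R) (z' : Fin K → R) :
    capPow (K + 1) y (Fin.cons x z') = ∑ p : Fin (K + 2), y ^ (p : ℕ) * x * capRest K y z' p := by
  rw [capPow, ← Finset.sum_fiberwise_of_maps_to (s := Finset.univ) (t := Finset.univ)
    (g := fun σ : Perm (Fin (K + 2)) => σ 0) fun _ _ => Finset.mem_univ _]
  refine Finset.sum_congr rfl fun p _ => ?_
  rw [capRest, Finset.mul_sum]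
  refine Finset.sum_congr rfl fun σ hσ => ?_
  rw [Finset.mem_filter] at hσ
  rw [capMon_succ_cons, ← hσ.2, Units.smul_def, Units.smul_def, mul_smul_comm]

/-- Sums over the fibre `{σ | σ 0 = p}` are sums over `Perm (Fin (K+1))` through `decomposeFin`.
[folklore] -/
theorem sum_filter_apply_zero_eq {M : Type*} [AddCommMonoid M] (K : ℕ) (p : Fin (K + 2))
    (f : Perm (Fin (K + 2)) → M) :
    ∑ σ ∈ Finset.univ.filter (fun σ : Perm (Fin (K + 2)) => σ 0 = p), f σ =
      ∑ e : Perm (Fin (K + 1)), f (Perm.decomposeFin.symm (p, e)) := by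
  rw [Finset.sum_filter, ← Equiv.sum_comp Perm.decomposeFin.symm, Fintype.sum_prod_type]
  simp only [Perm.decomposeFin_symm_apply_zero]
  exact Finset.sum_comm.trans (by simp)

/-- The exponents on the fibre over `Fin.last`: `σ (j+1) = finRotate (e j)` as natural numbers.
[folklore] -/
theorem val_decomposeFin_symm_last_succ (K : ℕ) (e : Perm (Fin (K + 1))) (j : Fin (K + 1)) :
    ((Perm.decomposeFin.symm (Fin.last (K + 1), e) j.succ : Fin (K + 2)) : ℕ) =
      (finRotate (K + 1) (e j) : ℕ) := by
  rw [Perm.decomposeFin_symm_apply_succ]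
  by_cases h : e j = Fin.last K
  · rw [h, Fin.succ_last, swap_apply_right, finRotate_last]
    rfl
  · rw [coe_finRotate_of_ne_last h, swap_apply_of_ne_of_ne (Fin.succ_ne_zero _)
      (fun h' => h (Fin.succ_injective _ (h'.trans (Fin.succ_last K).symm))), Fin.val_succ]

/-- The fibre sum over `Fin.last` is, up to sign, the Cayley–Hamilton–Capelli polynomial of one
order less: `R_last = (-1)^{K+1} P_K(y; z')`. [folklore] -/
theorem capRest_last (K : ℕ) (y : R) (z' : Fin K → R) :
    capRest K y z' (Fin.last (K + 1)) = ((-1 : ℤ) ^ (K + 1)) • capPow K y z' := by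
  rw [capRest, sum_filter_apply_zero_eq, capPow, Finset.smul_sum]
  conv_rhs => rw [← Equiv.sum_comp (Equiv.mulLeft (finRotate (K + 1)))]
  refine Finset.sum_congr rfl fun e _ => ?_
  have htail : capTail K y z' (Perm.decomposeFin.symm (Fin.last (K + 1), e)) =
      capMon K y z' (Equiv.mulLeft (finRotate (K + 1)) e) := by
    simp only [capTail, capMon, Equiv.coe_mulLeft, Perm.coe_mul, Function.comp_apply]
    rw [← Fin.succ_zero_eq_one, val_decomposeFin_symm_last_succ]
    congr 2
    exact congrArg List.ofFn (funext fun i => by rw [val_decomposeFin_symm_last_succ])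
  have hsign : (Perm.sign (Perm.decomposeFin.symm (Fin.last (K + 1), e)) : ℤ) =
      (-1) ^ (K + 1) * (Perm.sign (Equiv.mulLeft (finRotate (K + 1)) e) : ℤ) := by
    rw [Perm.decomposeFin.symm_sign, if_neg (Fin.last_pos'.ne'), Equiv.coe_mulLeft, Perm.sign_mul,
      sign_finRotate, Nat.add_sub_cancel]
    push_cast
    rw [← mul_assoc, ← pow_add, show K + 1 + K = 2 * K + 1 by ring, pow_succ, pow_mul, neg_one_sq,
      one_pow, one_mul]
  rw [htail, Units.smul_def, Units.smul_def, hsign, mul_smul]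

/-- **Tensor separation.** If `P_0, …, P_{m-1} ∈ M_n(ℂ)` are linearly independent and
`∑_i P_i X Q_i = 0` for every `X`, then every `Q_i = 0` (`M_n ⊗ M_nᵒᵖ ≅ End M_n`, in
coordinates). [folklore] -/
theorem eq_zero_of_sum_mul_mul_eq_zero {n m : ℕ} {P : Fin m → Matrix (Fin n) (Fin n) ℂ}
    (hP : LinearIndependent ℂ P) {Q : Fin m → Matrix (Fin n) (Fin n) ℂ}
    (h : ∀ X, ∑ i, P i * X * Q i = 0) (i : Fin m) : Q i = 0 := by
  ext t u
  have key : ∀ r s : Fin n, ∑ i, P i r s * Q i t u = 0 := by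
    intro r s
    have := congrFun (congrFun (h (Matrix.single s t 1)) r) u
    simpa [Matrix.sum_apply, LongMasqueradeNeg.sandwich_single_apply] using this
  have hcomb : ∑ i, Q i t u • P i = 0 := by
    ext r s
    simp only [Matrix.sum_apply, Matrix.smul_apply, smul_eq_mul, Matrix.zero_apply]
    simpa [mul_comm] using key r s
  exact Fintype.linearIndependent_iff.1 hP _ hcomb i

end expansion

/-! ### The algebraicity dichotomy -/

section dichotomy

/-- **All fibre sums vanish** (uniform in the point size `K + 1`).  Let `A` masquerade as `M_{K+1}` to
degree `2d` and generate `M_n` in degree `d`; let `Y ∈ V_L` have linearly independent powers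
`1, Y, …, Y^{K+1}`, with budget `L(K+1)(K+2)/2 + d + K e ≤ 2d`.  Then every fibre sum `R_p(Z')` of the
expansion `P_{K+1}(Y; X, Z') = ∑_p Y^p X R_p(Z')` vanishes for `Z' ∈ V_e^K` (full slot `X ∈ V_d = M_n`,
tensor separation).  `R_p` is, up to sign, the Capelli polynomial of the `K+1` powers other than `Y^p`.
[folklore] -/
theorem capRest_eq_zero_of_window {n d K : ℕ} {A : Fin 2 → Matrix (Fin n) (Fin n) ℂ}
    (hspan : Submodule.span ℂ {M : Matrix (Fin n) (Fin n) ℂ |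
      ∃ w : List (Fin 2), w.length ≤ d ∧ (w.map A).prod = M} = ⊤)
    (hmasq : ∀ (T : Finset (List (Fin 2))) (c : List (Fin 2) → ℂ), (∀ w ∈ T, w.length ≤ 2 * d) →
      (∀ B : Fin 2 → Matrix (Fin (K + 1)) (Fin (K + 1)) ℂ, (∑ w ∈ T, c w • (w.map B).prod) = 0) →
      (∑ w ∈ T, c w • (w.map A).prod) = 0)
    {L e : ℕ} (hbudget : L * ((K + 1) * (K + 2) / 2) + d + K * e ≤ 2 * d)
    {Y : Matrix (Fin n) (Fin n) ℂ} (hY : Y ∈ wordSpan A L)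
    (hind : LinearIndependent ℂ (fun j : Fin (K + 2) => Y ^ (j : ℕ)))
    {Z' : Fin K → Matrix (Fin n) (Fin n) ℂ} (hZ' : ∀ i, Z' i ∈ wordSpan A e) (p : Fin (K + 2)) :
    capRest K Y Z' p = 0 := by
  have hX : ∀ X : Matrix (Fin n) (Fin n) ℂ, X ∈ wordSpan A d := fun X => by
    change X ∈ Submodule.span ℂ _
    rw [hspan]
    exact Submodule.mem_top
  have hvan : ∀ X : Matrix (Fin n) (Fin n) ℂ,
      ∑ p : Fin (K + 2), Y ^ (p : ℕ) * X * capRest K Y Z' p = 0 := by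
    intro X
    rw [← capPow_succ_cons]
    refine capPow_eq_zero_of_window hmasq (L := L) (e := Fin.cons d fun _ => e) ?_ hY ?_
    · rw [Fin.sum_univ_succ]
      simp only [Fin.cons_zero, Fin.cons_succ, Finset.sum_const, Finset.card_univ,
        Fintype.card_fin, smul_eq_mul]
      have h2 : (K + 1) * (K + 1 + 1) / 2 = (K + 1) * (K + 2) / 2 := rfl
      rw [h2]
      linarith
    · refine Fin.cases ?_ ?_
      · simpa using hX X
      · intro i
        simpa using hZ' i
  exact eq_zero_of_sum_mul_mul_eq_zero hind hvan p

/-- **Algebraicity dichotomy** (uniform in the point size `K + 1`).  Let `A` masquerade as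
`M_{K+1}` to degree `2d` and generate `M_n` in degree `d`.  For `Y ∈ V_L`, with budget
`L(K+1)(K+2)/2 + d + K e ≤ 2d`: either the powers `1, Y, …, Y^{K+1}` are linearly dependent, or
`P_K(Y; Z') = 0` for all `Z' ∈ V_e^K` (the fibre over `Fin.last` of `capRest_eq_zero_of_window`).
[folklore] -/
theorem capPow_dichotomy {n d K : ℕ} {A : Fin 2 → Matrix (Fin n) (Fin n) ℂ}
    (hspan : Submodule.span ℂ {M : Matrix (Fin n) (Fin n) ℂ |
      ∃ w : List (Fin 2), w.length ≤ d ∧ (w.map A).prod = M} = ⊤)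
    (hmasq : ∀ (T : Finset (List (Fin 2))) (c : List (Fin 2) → ℂ), (∀ w ∈ T, w.length ≤ 2 * d) →
      (∀ B : Fin 2 → Matrix (Fin (K + 1)) (Fin (K + 1)) ℂ, (∑ w ∈ T, c w • (w.map B).prod) = 0) →
      (∑ w ∈ T, c w • (w.map A).prod) = 0)
    {L e : ℕ} (hbudget : L * ((K + 1) * (K + 2) / 2) + d + K * e ≤ 2 * d)
    {Y : Matrix (Fin n) (Fin n) ℂ} (hY : Y ∈ wordSpan A L) :
    ¬ LinearIndependent ℂ (fun j : Fin (K + 2) => Y ^ (j : ℕ)) ∨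
      ∀ Z' : Fin K → Matrix (Fin n) (Fin n) ℂ, (∀ i, Z' i ∈ wordSpan A e) → capPow K Y Z' = 0 := by
  by_cases hind : LinearIndependent ℂ (fun j : Fin (K + 2) => Y ^ (j : ℕ))
  · refine Or.inr fun Z' hZ' => ?_
    have h := capRest_eq_zero_of_window hspan hmasq hbudget hY hind hZ' (Fin.last (K + 1))
    rw [capRest_last] at h
    have : ((-1 : ℤ) ^ (K + 1) * (-1) ^ (K + 1)) • capPow K Y Z' = 0 := by
      rw [mul_smul, h, smul_zero]
    rwa [← pow_add, ← two_mul, pow_mul, neg_one_sq, one_pow, one_smul] at this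
  · exact Or.inl hind

end dichotomy

end Masquerade

end Summit.MatrixMultiplication.MatrixMultiplication.Theorems
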